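import Summits.HodgeConjecture.HodgeConjecture.Theorems.F0P2oLineWeilDictionaryFrameTransportOfRecord  -- ★ p837171 A-p01 (g19): `lineSplittingsCM_s_eq_localSplittingCM` (the line package IS ★ `localSplittingCM`)
import Literature.NumberTheory.Automorphic.UnitaryGroupDualPairLocalLine                                -- ★ `localLineInl`, `localLineInl_localCenter`
import HarnessLib

/-!
# Crux `H413` — N3 ROAD (a), row (C5b): THE LINE-SIDE IDENTITY at the block frame — `ω_{T₁}(s_{T₁}(g₁ ⊗ 1)) = ω¹(u)`

F0∕P2, cell `hodgecm-mathlib` (D-0151), crux item `stmt-HodgeConjecture-24833` (binder h413), programme P2, N3 road (a) of the K1 lead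
B-p18 (g29) (word 2026-09-01T00:02:53Z (C5b)); seat B-p08 (g25).  THEOREMS ONLY (no `def`, no instance, no notation, no named fact, no `sorry`);
kernel lane `--supports stmt-HodgeConjecture-24833 --as helper`.  HONEST LABEL: HC_CM is proved only modulo the 2 remaining named inputs (hLiu418,
h413) — behind them the booked printed statements + the MOD package — until rung 0 closes; this file proves NO letter: it is the rank-one step of
(C5) «(N′) at the block frame» for N3 #96 (`GelbartRogawski1991.thetaType_nonsplit_jacquetModule`).

THE MATHEMATICS [GelbartRogawski1991 §3.2 (3.2.1) p. 457; §5.2 p. 467 L8–11].  After the local see-saw ★ (LS)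
`DoubledBlock.toRep_localSplittingCMWith_inlLoc_boxSB_of_eq`, the action of the line element `d(1, β, 1)` on `r_N(ω_v)` at the block frame is the RANK-ONE
CM Weil representation `ω_{T₁} ∘ s_{T₁}` of the pair `U(⟨dL⟩) × U(⟨ε⟩)` (`T₁ = gram e₀ (realDiagonal dL) (ε)`), evaluated at the `U(⟨dL⟩)`-member
`localLineInl e₀ g₁` of a `1 × 1` unitary `g₁` with entry `β = det u`.  GR's `ω¹(u)` = ★ `lineWeilCM L e₀ dL … μ hμ ε v u` is the SAME package evaluated at the
`U(⟨ε⟩)`-member `localCenter u`; for `1 × 1` matrices the two members coincide (`g₁ ⊗ 1 = det u · 1`, ★ `localLineInl_localCenter`), and the package of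
record IS ★ `localSplittingCM` (A-p01 ★ `lineSplittingsCM_s_eq_localSplittingCM`).

§0 `localSplittingCMWith_addHaar` — under `[BorelSpace]`, ★ `localSplittingCMWith … Measure.addHaar = localSplittingCM …` (the (LS)∕(U) lemmas speak
`localSplittingCMWith … μ`; the packages of record speak `localSplittingCM`).  §1 `eq_localCenter_of_val_eq` ∕ `localLineInl_eq_localCenter_of_val_eq` — a
`1 × 1` unitary `g₁ ∈ U(diag dL)(L⁺_v)` whose entry is `det u` IS `localCenter u`, hence `localLineInl e₀ g₁ = localCenter u` in the pair group.
§2 **(C5b) `toRep_localSplittingCM_localLineInl_eq_lineWeilCM`** (+ the `localSplittingCMWith … addHaar` edition under `[BorelSpace]`).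

## References
* [GelbartRogawski1991] S. Gelbart, J. Rogawski, Invent. Math. 105 (1991): §3.2 (3.2.1) p. 457; §5.2 p. 467 L8–11; Remark p. 466.
* [Mok2014] C. P. Mok, Mem. AMS 235 (2015): §1 Notation p. 5 (the centre `E¹_v` as scalar unitary matrices).
* [MoeglinVignerasWaldspurger1987] LNM 1291 (1987): Chap. 2 II.1 (the Weil representation along a splitting).
-/

set_option autoImplicit false
-- the mandated namespace has the single-problem summit's repeated segment (`HodgeConjecture.HodgeConjecture`)
set_option linter.dupNamespace false

noncomputable section

open NumberField IsDedekindDomain MeasureTheory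
open scoped Matrix Kronecker

open Literature.NumberTheory Literature.NumberTheory.Automorphic Literature.NumberTheory.Automorphic.UnitaryGroup
open Literature.NumberTheory.Automorphic.IdeleClassGroup
open Literature.NumberTheory.Automorphic.Liu2021 Literature.NumberTheory.Automorphic.Liu2021.Def411WeilCarriers
open Literature.NumberTheory.Automorphic.Liu2021.Def411WeilCarriersDoubling
open Literature.NumberTheory.GelbartRogawski1991 Literature.NumberTheory.GelbartRogawski1991.UnitaryDualPair
open Literature.NumberTheory.GelbartRogawski1991.UnitaryDualPair.LocalSplitting Literature.NumberTheory.GelbartRogawski1991.UnitaryDualPair.WeilCoinv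
open Literature.NumberTheory.GelbartRogawski1991.GRConstruction
open Literature.RepresentationTheory Literature.RepresentationTheory.HeisenbergGroup Literature.RepresentationTheory.Liu2021
open Literature.NumberTheory.GaloisRepresentations Literature.RepresentationTheory.HarrisKudlaSweet1996
open Literature.NumberTheory.Rogawski1990

open Summit.HodgeConjecture.HodgeConjecture.Cruxes.H413.F0P2oLineWeilDictionaryFrameTransportOfRecord

namespace Summit.HodgeConjecture.HodgeConjecture.Cruxes.H413.F0P2oBlockFrameLineSide

variable (L : Type) [Field L] [NumberField L] [IsCMField L] (v : HeightOneSpectrum (𝓞 ↥(maximalRealSubfield L)))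

/-! ## §0 `localSplittingCMWith … addHaar = localSplittingCM` under the Borel σ-algebra -/

/-- **the (LS)∕(U) spelling meets the package of record**: for the Borel σ-algebra on `L⁺_v` (any `[BorelSpace]` instance — a `Prop`), ★ `localSplittingCMWith …
Measure.addHaar` IS ★ `localSplittingCM …` (whose body fixes `borel` and `addHaar`). [cite: GelbartRogawski1991, §3.1 Prop. 3.1.1 p. 455 L1–3] -/
theorem localSplittingCMWith_addHaar (n : ℕ) {T₀ : Matrix (Fin n) (Fin n) ↥(maximalRealSubfield L)} (hT₀ : T₀.IsSymm) (hT₀d : IsUnit T₀.det)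
    {J : Matrix (Fin n) (Fin n) L} (hJ : J = T₀.map (algebraMap (↥(maximalRealSubfield L)) L)) (χ : HeckeCharacter L) (hχ : IsSplittingChar L 1 χ)
    [inst : MeasurableSpace (v.adicCompletion ↥(maximalRealSubfield L))] [BorelSpace (v.adicCompletion ↥(maximalRealSubfield L))] :
    localSplittingCMWith L n hT₀ hT₀d hJ χ hχ v Measure.addHaar = localSplittingCM L n hT₀ hT₀d hJ χ hχ v := by
  obtain ⟨h⟩ := ‹BorelSpace (v.adicCompletion ↥(maximalRealSubfield L))›
  subst h
  rfl

/-! ## §1 A `1 × 1` unitary with entry `det u` is `localCenter u` -/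

section Center

variable (dL : Fin 1 → L) (ε : (↥(maximalRealSubfield L))ˣ)
  (g₁ : localPi L (IsCMField.complexConj L) 1 (Matrix.diagonal dL) v)
  (u : localPi L (IsCMField.complexConj L) 1 (JW (↥(maximalRealSubfield L)) L ε) v)
  (hg₁u : ((localPiEquiv L (IsCMField.complexConj L) 1 (Matrix.diagonal dL) v g₁ : GL (Fin 1) (UnitaryGroup.LocalRing L v))).val 0 0 =
    (((localDet (IsCMField.complexConj L) v (isUnit_iff_ne_zero.mpr (by rw [Matrix.det_fin_one]; exact JW_apply_ne_zero (↥(maximalRealSubfield L)) L ε))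
      (localPiEquiv L (IsCMField.complexConj L) 1 (JW (↥(maximalRealSubfield L)) L ε) v u) : ↥(normOneUnits (conjLocal L (IsCMField.complexConj L) v))) :
        (UnitaryGroup.LocalRing L v)ˣ) : UnitaryGroup.LocalRing L v))

include hg₁u in
/-- **a `1 × 1` unitary `g₁ ∈ U(diag dL)(L⁺_v)` with entry `det u` IS the central element `localCenter u`** (`u ∈ U(⟨ε⟩)(L⁺_v)`; both are the family
`𝔴 ↦ (det u)_𝔴` of `1 × 1` matrices — the `1 × 1` unitary groups of all lines are the same norm-one torus `E¹_v`). [cite: Mok2014, §1 Notation p. 5]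
[cite: GelbartRogawski1991, Remark p. 466] -/
theorem eq_localCenter_of_val_eq :
    g₁ = localCenter L (IsCMField.complexConj L) 1 (Matrix.diagonal dL) (JW (↥(maximalRealSubfield L)) L ε) (JW_apply_ne_zero (↥(maximalRealSubfield L)) L ε) v u := by
  refine Subtype.ext (funext fun 𝔴 => Units.ext (Matrix.ext fun i j => ?_))
  have hij : i = 0 ∧ j = 0 := ⟨Subsingleton.elim _ _, Subsingleton.elim _ _⟩
  obtain ⟨rfl, rfl⟩ := hij
  have h𝔴 := congrFun hg₁u 𝔴
  rw [coe_coe_localDet, Matrix.det_fin_one, coe_localPiEquiv_apply, coe_localPiEquiv_apply] at h𝔴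
  rw [coe_localCenter, coe_localScalarGL_apply, Matrix.smul_apply, Matrix.one_apply_eq, smul_eq_mul, mul_one]
  exact h𝔴

include hg₁u in
/-- **hence `localLineInl e₀ g₁ = localCenter u` in the pair group `U(diag dL ⊗ (ε))(L⁺_v)`** (★ `localLineInl_localCenter`): the `U(V₁)`-member and the
`U(W)`-member of the rank-(1,1) dual pair agree on `E¹_v`. [cite: GelbartRogawski1991, Remark p. 466; §5.2 p. 467 L8–11] [cite: Mok2014, §1 Notation p. 5] -/
theorem localLineInl_eq_localCenter_of_val_eq {n₀ : ℕ} (e₀ : Fin 1 × Fin 1 ≃ Fin n₀) :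
    localLineInl L (IsCMField.complexConj L) 1 e₀ (Matrix.diagonal dL) (JW (↥(maximalRealSubfield L)) L ε) v g₁ =
      localCenter L (IsCMField.complexConj L) n₀ (Matrix.reindex e₀ e₀ (Matrix.diagonal dL ⊗ₖ JW (↥(maximalRealSubfield L)) L ε))
        (JW (↥(maximalRealSubfield L)) L ε) (JW_apply_ne_zero (↥(maximalRealSubfield L)) L ε) v u := by
  rw [eq_localCenter_of_val_eq L v dL ε g₁ u hg₁u]
  exact localLineInl_localCenter L (IsCMField.complexConj L) 1 e₀ (Matrix.diagonal dL) (JW (↥(maximalRealSubfield L)) L ε)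
    (JW (↥(maximalRealSubfield L)) L ε) (JW_apply_ne_zero (↥(maximalRealSubfield L)) L ε) v u

end Center

/-! ## §2 (C5b) THE LINE-SIDE IDENTITY `ω_{T₁}(s_{T₁}(localLineInl e₀ g₁)) f = lineWeilCM … u f` -/

section LineSide

variable {n₀ : ℕ} (e₀ : Fin 1 × Fin 1 ≃ Fin n₀) (dL : Fin 1 → L) (hdL : ∀ i, IsCMField.complexConj L (dL i) = dL i) (hdL0 : ∀ i, dL i ≠ 0)
  (μ : Literature.NumberTheory.Automorphic.IdeleClassGroup L →ₜ* Circle) (hμ : IsConjugateSymplectic L μ) (ε : (↥(maximalRealSubfield L))ˣ)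
  (hT : (UnitaryDualPair.gram (↥(maximalRealSubfield L)) e₀ (realDiagonal L dL hdL) (TW (↥(maximalRealSubfield L)) ε)).IsSymm)
  (hTd : IsUnit (UnitaryDualPair.gram (↥(maximalRealSubfield L)) e₀ (realDiagonal L dL hdL) (TW (↥(maximalRealSubfield L)) ε)).det)
  (hJ : Matrix.reindex e₀ e₀ (Matrix.diagonal dL ⊗ₖ JW (↥(maximalRealSubfield L)) L ε) =
    (UnitaryDualPair.gram (↥(maximalRealSubfield L)) e₀ (realDiagonal L dL hdL) (TW (↥(maximalRealSubfield L)) ε)).map (algebraMap (↥(maximalRealSubfield L)) L))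
  (g₁ : localPi L (IsCMField.complexConj L) 1 (Matrix.diagonal dL) v)
  (u : localPi L (IsCMField.complexConj L) 1 (JW (↥(maximalRealSubfield L)) L ε) v)
  (hg₁u : ((localPiEquiv L (IsCMField.complexConj L) 1 (Matrix.diagonal dL) v g₁ : GL (Fin 1) (UnitaryGroup.LocalRing L v))).val 0 0 =
    (((localDet (IsCMField.complexConj L) v (isUnit_iff_ne_zero.mpr (by rw [Matrix.det_fin_one]; exact JW_apply_ne_zero (↥(maximalRealSubfield L)) L ε))
      (localPiEquiv L (IsCMField.complexConj L) 1 (JW (↥(maximalRealSubfield L)) L ε) v u) : ↥(normOneUnits (conjLocal L (IsCMField.complexConj L) v))) :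
        (UnitaryGroup.LocalRing L v)ˣ) : UnitaryGroup.LocalRing L v))
  (f : SchwartzBruhat (Fin n₀ → v.adicCompletion ↥(maximalRealSubfield L)))

include hg₁u in
set_option synthInstance.maxHeartbeats 400000 in
set_option maxHeartbeats 4000000 in
/-- **(C5b) THE LINE-SIDE IDENTITY AT THE BLOCK FRAME**: for the rank-(1,1) pair Gram `T₁ = gram e₀ (realDiagonal dL) (ε)` (ANY admissible proof arguments
`hT hTd hJ` — they are `Prop`s), a `1 × 1` unitary `g₁ ∈ U(diag dL)(L⁺_v)` with entry `det u` and `f ∈ 𝒮(L⁺_v^{n₀})`: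
`ω_{T₁}(localSplittingCM … (localLineInl e₀ g₁)) f = lineWeilCM L e₀ dL … μ hμ ε v u f` — §1 + `lineWeilCM = (lineSplittingsCM …).omegaLoc v ∘ localCenter`
(definitional) + A-p01 ★ `lineSplittingsCM_s_eq_localSplittingCM`.  With `e₀ := Equiv.prodUnique (Fin 1) (Fin 1)`, `dL := fun _ => dV′ 0` this is the line block
that ★ (LS) `toRep_localSplittingCMWith_inlLoc_boxSB_of_eq` leaves at the block frame `(dV′, pU₃)` (`hTsum` = ★ (β) `gram_prodUnique_realDiagonal_eq_finSum`).
[cite: GelbartRogawski1991, §3.2 (3.2.1) p. 457; §5.2 p. 467 L8–11] [cite: MoeglinVignerasWaldspurger1987, Chap. 2 II.1] -/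
theorem toRep_localSplittingCM_localLineInl_eq_lineWeilCM :
    MpPsi.toRep (localSchrodinger (↥(maximalRealSubfield L)) n₀
        (UnitaryDualPair.gram (↥(maximalRealSubfield L)) e₀ (realDiagonal L dL hdL) (TW (↥(maximalRealSubfield L)) ε)) v)
        (localSplittingCM L n₀ hT hTd hJ (toHeckeCharacter L μ) ((isOscillatorChar_toHeckeCharacter_iff μ).mpr hμ) v
          (localLineInl L (IsCMField.complexConj L) 1 e₀ (Matrix.diagonal dL) (JW (↥(maximalRealSubfield L)) L ε) v g₁)) f =
      lineWeilCM L e₀ dL hdL hdL0 μ hμ ε v u f := by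
  rw [localLineInl_eq_localCenter_of_val_eq L v dL ε g₁ u hg₁u e₀]
  change _ = MpPsi.toRep (localSchrodinger (↥(maximalRealSubfield L)) n₀ _ v)
    ((lineSplittingsCM L e₀ dL hdL hdL0 (toHeckeCharacter L μ) ((isOscillatorChar_toHeckeCharacter_iff μ).mpr hμ) ε).s v
      (localCenter L (IsCMField.complexConj L) n₀ (Matrix.reindex e₀ e₀ (Matrix.diagonal dL ⊗ₖ JW (↥(maximalRealSubfield L)) L ε))
        (JW (↥(maximalRealSubfield L)) L ε) (JW_apply_ne_zero (↥(maximalRealSubfield L)) L ε) v u)) f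
  rw [lineSplittingsCM_s_eq_localSplittingCM]

include hg₁u in
set_option synthInstance.maxHeartbeats 400000 in
set_option maxHeartbeats 4000000 in
/-- **(C5b) in the (LS)∕(U) spelling**: under any `[BorelSpace]` instance on `L⁺_v`, `ω_{T₁}(localSplittingCMWith … Measure.addHaar (localLineInl e₀ g₁)) f =
lineWeilCM L e₀ dL … μ hμ ε v u f` (§0 + the previous theorem) — LITERALLY the left block that ★ (LS) `toRep_localSplittingCMWith_inlLoc_boxSB_of_eq` outputs.
[cite: GelbartRogawski1991, §3.2 (3.2.1) p. 457; §5.2 p. 467 L8–11] [cite: Kudla1984, §1] -/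
theorem toRep_localSplittingCMWith_addHaar_localLineInl_eq_lineWeilCM
    [MeasurableSpace (v.adicCompletion ↥(maximalRealSubfield L))] [BorelSpace (v.adicCompletion ↥(maximalRealSubfield L))] :
    MpPsi.toRep (localSchrodinger (↥(maximalRealSubfield L)) n₀
        (UnitaryDualPair.gram (↥(maximalRealSubfield L)) e₀ (realDiagonal L dL hdL) (TW (↥(maximalRealSubfield L)) ε)) v)
        (localSplittingCMWith L n₀ hT hTd hJ (toHeckeCharacter L μ) ((isOscillatorChar_toHeckeCharacter_iff μ).mpr hμ) v Measure.addHaar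
          (localLineInl L (IsCMField.complexConj L) 1 e₀ (Matrix.diagonal dL) (JW (↥(maximalRealSubfield L)) L ε) v g₁)) f =
      lineWeilCM L e₀ dL hdL hdL0 μ hμ ε v u f := by
  rw [localSplittingCMWith_addHaar]
  exact toRep_localSplittingCM_localLineInl_eq_lineWeilCM L v e₀ dL hdL hdL0 μ hμ ε hT hTd hJ g₁ u hg₁u f

end LineSide

end Summit.HodgeConjecture.HodgeConjecture.Cruxes.H413.F0P2oBlockFrameLineSide

end
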